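import Summits.NavierStokesRegularity.NavierStokesRegularity.Theorems.ScenarioCensusRowF1SpacetimeLocusTransfer
import Summits.NavierStokesRegularity.NavierStokesRegularity.Theorems.ScenarioCensusRowF1SpacetimeLocusKill
import HarnessLib

/-!
# LINE 32 «spacetime-locus» port, part 4/4: §10 THE ROWS — `Row_F1belT` / `Row_F1calmT` / `Row_F1slowT` (thick ends) and `Row_F1slow` (slow-dense end), floors
# `GenericTwistedBalls` / `GenericVorticalBalls` / `GenericFastBalls` / `RecurrentFastBalls`, residuals ≡ `Row_F1`, bookkeeping identities, splits; census KEYS `Row_F1belT` /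
# `Row_F1calmT` / `Row_F1slowT` / `Row_F1slow` + `_excluded`, floors GTB / GVB / GFB / RFB

Re-homed for the scenario census (typer seat ns-census-typer-1 g9; the thick cells F1βT / F1ωT / F1∣u∣T, the dense cell F1∣u∣d and the floors GTB / GVB / GFB / RFB are
MEMBERS OF RECORD «DECIDED IN KERNEL IN FILES» of row F1 since census v1.95 (critic idea-crit-3 g8 PASS 07:50:52Z — no price; ref ns-census-ref g12 PRE-CHECK ✓ §17.9 item
63; lead-presearch label item 63); this port makes them TREE-decided): VERBATIM PORT of the NEW sections (§8–§10) of ns-idea-3 LINE 32 «spacetime-locus»,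
`pub/ideators/ns-idea-3/lines/spacetime-locus/line-spacetime-locus.lean` sha16 a2ef5b2867fe7a2c (2078 l., lean check rc 0, 0 sorry; its §1–§7 = LINES 27–31 VERBATIM,
taken BY NAME from the landed liouville-socket / sharp-top / thin-top / event-socket / dense-locus ports), split for the 400-line rule into `ScenarioCensusRowF1SpacetimeLocus`
(§8 vocabulary) → `…SpacetimeLocusTransfer` (§8 transfer + engine) → `…SpacetimeLocusKill` (§9) → `…SpacetimeLocusRows` (§10 + census KEYS).  Lean text VERBATIM in
namespace `…Theorems.ScenarioCensus.SpacetimeLocus` (the line's `…Cruxes.ScenarioCensusRowF1.SpacetimeLocusLine` re-homed) with the five predecessor namespaces opened; port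
edits: the bracket lines `section Thick` / `end Thick` dropped and its `variable {F : Type*} [NormedAddCommGroup F]` repeated at the head of the two §8 parts, §8's VERBATIM
restatement of LINE 29's `volume_preimage_zoomTime` not re-declared (BY NAME), `@[conjecture]` on the residuals `BelThickSlack` / `CalmThickSlack` / `SlowThickSlack`
(≡ `ScenarioCensus.Row_F1`, OPEN), one-line docstrings added where missing (gate lint).  Statements untouched.

No census VALUE is moved here (row F1 stays OPEN-WITH-LINE; the members become TREE-decided by name); NS regularity is NOT proved; `Row_F1` is untouched (zero
movement, `belThickSlack_iff_rowF1` / `calmThickSlack_iff_rowF1` / `slowThickSlack_iff_rowF1`); no summit statement is proved by this file. Lemmas that restate already-landed tree declarations are taken BY NAME (gate lint `dedup.landed`): `fderiv_smul_stPull_apply` = `InviscidTop.fderiv_smul_stPull_apply`, `fderiv_smul_stPull` = `InviscidTop.fderiv_smul_stPull`, `fderiv_fderiv_smul_stPull` = `InviscidTop.fderiv_fderiv_smul_stPull`, `tendsto_clm_of_tendsto_apply` = `InviscidTop.tendsto_clm_of_tendsto_apply`, `tendsto_fderiv_fderiv_apply_of_bound` = `InviscidTop.tendsto_fderiv_fderiv_apply_of_bound`,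 `tendsto_fderiv_fderiv_of_bound` = `InviscidTop.tendsto_fderiv_fderiv_of_bound`, `tendsto_fderiv_fderiv_of_typeI_seq_Ioo` = `InviscidTop.tendsto_fderiv_fderiv_of_typeI_seq_Ioo`, `fderiv3_smul_stPull` = `FrozenTop.fderiv3_smul_stPull`, `tendsto_fderiv3_of_typeI_seq_Ioo` = `FrozenTop.tendsto_fderiv3_of_typeI_seq_Ioo`, `tendsto_physicalTime` = `ColumnarTop.tendsto_physicalTime`, `eventually_fast` = `ColumnarTop.eventually_fast`, `sqrt_timeLag` = `StretchedTop.sqrt_timeLag`, `forall_of_forall_ne_zero` = `StretchedTop.forall_of_forall_ne_zero`, `radius_eq` = `FrozenTop.radius_eq`, `jointCond_everywhere₆` = `FrozenTop.jointCond_everywhere₄`, `continuousOn_quad` = `IntegratedStretch.continuousOn_quad`, `sqrt_nu_timeLag` = `IntegratedStretch.sqrt_nu_timeLag`, `sing_of_not_bounded` = `InviscidTop.sing_of_not_bounded`, `exists_singularZoom_package₃` = `FrozenTop.exists_singularZoom_package₃`, `lapD_eq_zero_of_eq_zero` = `FrozenTop.lapD_eq_zero_of_eq_zero`, `measurableSet_top`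 = `IntegratedStretch.measurableSet_top`.
-/

-- the summit and its single problem share the name `NavierStokesRegularity` (D-0017 nested layout)
set_option linter.dupNamespace false

noncomputable section

open MeasureTheory Set Function Filter TopologicalSpace Metric
open scoped Topology NNReal ENNReal InnerProductSpace RealInnerProductSpace Laplacian

namespace Summit.NavierStokesRegularity.NavierStokesRegularity.Theorems.ScenarioCensus.SpacetimeLocus

open Literature.Analysis Literature.Analysis.FluidPDE
open Summit.NavierStokesRegularity.NavierStokesRegularity.Theorems
open Summit.NavierStokesRegularity.NavierStokesRegularity.Theorems.ScenarioCensus.LiouvilleSocket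
open Summit.NavierStokesRegularity.NavierStokesRegularity.Theorems.ScenarioCensus.SharpTop
open Summit.NavierStokesRegularity.NavierStokesRegularity.Theorems.ScenarioCensus.ThinTop
open Summit.NavierStokesRegularity.NavierStokesRegularity.Theorems.ScenarioCensus.EventSocket
open Summit.NavierStokesRegularity.NavierStokesRegularity.Theorems.ScenarioCensus.DenseLocus

/-! ## §10 THE ROWS OF THIS LINE: three «THICK-END» criterion rows (PROVED), three floors (PROVED), three residuals
(≡ `Row_F1`); and LINE 31-shape corollaries for the speed defect -/

/-- **Row «BELTRAMI-THICK END ⇒ no Type-I blow-up»**: if for some `δ, ρ`, window shape and `η`, for every `ε > 0`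
the times at which EVERY parabolic ball `B(x, ρ√(ν(T−t)))` is `δ`-filled by `ε`-Beltrami points
(`(T−t)^{3/2} ν^{−1/2} |ω × u| < ε`) have lower scale-density `≥ η` in the late windows, then `u` extends smoothly. -/
def Row_F1belT : Prop :=
  ∀ (ν T : ℝ), 0 < ν → 0 < T → ∀ (u : ℝ → E3 → E3) (p : ℝ → E3 → ℝ),
    IsClassicalNSSolutionOn (Ico 0 T) ν 0 u p → IsLerayHopfOn T ν 0 (u 0) u → HasRapidSpatialDecay (u 0) →
    IsTypeIBlowup u T → ThickNear lambOf T ν u → HasSmoothExtensionPast ν 0 u T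

/-- **Row «CALM-THICK END ⇒ no Type-I blow-up»** (`ε`-irrotational points `(T − t)|ω| < ε`). -/
def Row_F1calmT : Prop :=
  ∀ (ν T : ℝ), 0 < ν → 0 < T → ∀ (u : ℝ → E3 → E3) (p : ℝ → E3 → ℝ),
    IsClassicalNSSolutionOn (Ico 0 T) ν 0 u p → IsLerayHopfOn T ν 0 (u 0) u → HasRapidSpatialDecay (u 0) →
    IsTypeIBlowup u T → ThickNear vortOf T ν u → HasSmoothExtensionPast ν 0 u T

/-- **Row «SLOW-THICK END ⇒ no Type-I blow-up»** (`ε`-slow points `|u|² < ε² ν/(T − t)`; kill = analyticity ALONE). -/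
def Row_F1slowT : Prop :=
  ∀ (ν T : ℝ), 0 < ν → 0 < T → ∀ (u : ℝ → E3 → E3) (p : ℝ → E3 → ℝ),
    IsClassicalNSSolutionOn (Ico 0 T) ν 0 u p → IsLerayHopfOn T ν 0 (u 0) u → HasRapidSpatialDecay (u 0) →
    IsTypeIBlowup u T → ThickNear spdOf T ν u → HasSmoothExtensionPast ν 0 u T

/-- **Row «SLOW-DENSE END ⇒ no Type-I blow-up»** (LINE 31's persistent shape for the NEW speed defect). -/
def Row_F1slow : Prop :=
  ∀ (ν T : ℝ), 0 < ν → 0 < T → ∀ (u : ℝ → E3 → E3) (p : ℝ → E3 → ℝ),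
    IsClassicalNSSolutionOn (Ico 0 T) ν 0 u p → IsLerayHopfOn T ν 0 (u 0) u → HasRapidSpatialDecay (u 0) →
    IsTypeIBlowup u T → DenseNear spdOf T ν u → HasSmoothExtensionPast ν 0 u T

/-- **Floor «SCALE-GENERIC TWISTED BALLS»**: at a maximal Type-I blow-up, for all `δ, ρ > 0`, every window shape
`0 < a < b` and every `η > 0` there is `ε > 0` such that along a sequence of scales `l → 0⁺` the times of
`[T − l b, T − l a]` at which every parabolic ball is `δ`-filled by `ε`-Beltrami points have measure `< η l` — at all
other times of the window SOME parabolic ball is more than `(1 − δ)`-filled by `ε`-TWISTED points. -/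
def GenericTwistedBalls : Prop :=
  ∀ (ν T : ℝ), 0 < ν → 0 < T → ∀ (u : ℝ → E3 → E3) (p : ℝ → E3 → ℝ),
    IsMaximalSmoothSolution ν 0 u p T → IsLerayHopfOn T ν 0 (u 0) u → HasRapidSpatialDecay (u 0) →
    IsTypeIBlowup u T → ¬ ThickNear lambOf T ν u

/-- **Floor «SCALE-GENERIC VORTICAL BALLS»** (same, `ε`-vortical points `(T − t)|ω| ≥ ε`). -/
def GenericVorticalBalls : Prop :=
  ∀ (ν T : ℝ), 0 < ν → 0 < T → ∀ (u : ℝ → E3 → E3) (p : ℝ → E3 → ℝ),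
    IsMaximalSmoothSolution ν 0 u p T → IsLerayHopfOn T ν 0 (u 0) u → HasRapidSpatialDecay (u 0) →
    IsTypeIBlowup u T → ¬ ThickNear vortOf T ν u

/-- **Floor «SCALE-GENERIC FAST BALLS»** (same, `ε`-fast points `|u|² ≥ ε² ν/(T − t)`). -/
def GenericFastBalls : Prop :=
  ∀ (ν T : ℝ), 0 < ν → 0 < T → ∀ (u : ℝ → E3 → E3) (p : ℝ → E3 → ℝ),
    IsMaximalSmoothSolution ν 0 u p T → IsLerayHopfOn T ν 0 (u 0) u → HasRapidSpatialDecay (u 0) →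
    IsTypeIBlowup u T → ¬ ThickNear spdOf T ν u

/-- **Floor «RECURRENT FAST BALLS»** (LINE 31's shape for the speed defect: recurrently some parabolic ball is more
than `(1 − δ)`-filled by `ε`-fast points). -/
def RecurrentFastBalls : Prop :=
  ∀ (ν T : ℝ), 0 < ν → 0 < T → ∀ (u : ℝ → E3 → E3) (p : ℝ → E3 → ℝ),
    IsMaximalSmoothSolution ν 0 u p T → IsLerayHopfOn T ν 0 (u 0) u → HasRapidSpatialDecay (u 0) →
    IsTypeIBlowup u T → ¬ DenseNear spdOf T ν u

/-- **Residual «BELTRAMI-THICK SLACK»** — EQUIVALENT to `Row_F1`; not claimed. -/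
@[conjecture] def BelThickSlack : Prop :=
  ∀ (ν T : ℝ), 0 < ν → 0 < T → ∀ (u : ℝ → E3 → E3) (p : ℝ → E3 → ℝ),
    IsMaximalSmoothSolution ν 0 u p T → IsLerayHopfOn T ν 0 (u 0) u → HasRapidSpatialDecay (u 0) →
    IsTypeIBlowup u T → ThickNear lambOf T ν u

/-- **Residual «CALM-THICK SLACK»** — EQUIVALENT to `Row_F1`; not claimed. -/
@[conjecture] def CalmThickSlack : Prop :=
  ∀ (ν T : ℝ), 0 < ν → 0 < T → ∀ (u : ℝ → E3 → E3) (p : ℝ → E3 → ℝ),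
    IsMaximalSmoothSolution ν 0 u p T → IsLerayHopfOn T ν 0 (u 0) u → HasRapidSpatialDecay (u 0) →
    IsTypeIBlowup u T → ThickNear vortOf T ν u

/-- **Residual «SLOW-THICK SLACK»** — EQUIVALENT to `Row_F1`; not claimed. -/
@[conjecture] def SlowThickSlack : Prop :=
  ∀ (ν T : ℝ), 0 < ν → 0 < T → ∀ (u : ℝ → E3 → E3) (p : ℝ → E3 → ℝ),
    IsMaximalSmoothSolution ν 0 u p T → IsLerayHopfOn T ν 0 (u 0) u → HasRapidSpatialDecay (u 0) →
    IsTypeIBlowup u T → ThickNear spdOf T ν u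

/-! ### Bookkeeping identities (the rows ARE the engine at the three defects) -/
/-- `Row_F1belT` is the thick engine row of the Lamb defect. -/
theorem row_F1belT_eq : Row_F1belT = ThickRow lambOf := rfl
/-- `Row_F1calmT` is the thick engine row of the vorticity defect. -/
theorem row_F1calmT_eq : Row_F1calmT = ThickRow vortOf := rfl
/-- `Row_F1slowT` is the thick engine row of the speed defect. -/
theorem row_F1slowT_eq : Row_F1slowT = ThickRow spdOf := rfl
/-- `Row_F1slow` is the dense engine row of the speed defect. -/
theorem row_F1slow_eq : Row_F1slow = LocRow spdOf := rfl
/-- The floor GTB is the thick engine floor of the Lamb defect. -/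
theorem genericTwistedBalls_eq : GenericTwistedBalls = ThickFloor lambOf := rfl
/-- The floor GVB is the thick engine floor of the vorticity defect. -/
theorem genericVorticalBalls_eq : GenericVorticalBalls = ThickFloor vortOf := rfl
/-- The floor GFB is the thick engine floor of the speed defect. -/
theorem genericFastBalls_eq : GenericFastBalls = ThickFloor spdOf := rfl
/-- The floor RFB is the dense engine floor of the speed defect. -/
theorem recurrentFastBalls_eq : RecurrentFastBalls = LocFloor spdOf := rfl
/-- `BelThickSlack` is the thick engine slack of the Lamb defect. -/
theorem belThickSlack_eq : BelThickSlack = ThickSlack lambOf := rfl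
/-- `CalmThickSlack` is the thick engine slack of the vorticity defect. -/
theorem calmThickSlack_eq : CalmThickSlack = ThickSlack vortOf := rfl
/-- `SlowThickSlack` is the thick engine slack of the speed defect. -/
theorem slowThickSlack_eq : SlowThickSlack = ThickSlack spdOf := rfl

/-! ### The rows and floors are THEOREMS -/

/-- **`Row_F1belT` holds.** -/
theorem rowF1belT_holds : Row_F1belT := thickRow_of_kills continuous_lambOf thickLocusKills_lambOf
/-- **`Row_F1calmT` holds.** -/
theorem rowF1calmT_holds : Row_F1calmT := thickRow_of_kills continuous_vortOf thickLocusKills_vortOf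
/-- **`Row_F1slowT` holds.** -/
theorem rowF1slowT_holds : Row_F1slowT := thickRow_of_kills continuous_spdOf thickLocusKills_spdOf
/-- **`Row_F1slow` holds** (LINE 31's engine at the speed defect; kill by analyticity alone). -/
theorem rowF1slow_holds : Row_F1slow := locRow_of_kills continuous_spdOf locusKills_spdOf

/-- **The floors hold.** -/
theorem genericTwistedBalls_holds : GenericTwistedBalls := thickFloor_of_kills continuous_lambOf thickLocusKills_lambOf
/-- **Floor GVB holds.** -/
theorem genericVorticalBalls_holds : GenericVorticalBalls := thickFloor_of_kills continuous_vortOf thickLocusKills_vortOf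
/-- **Floor GFB holds.** -/
theorem genericFastBalls_holds : GenericFastBalls := thickFloor_of_kills continuous_spdOf thickLocusKills_spdOf
/-- **Floor RFB holds.** -/
theorem recurrentFastBalls_holds : RecurrentFastBalls := locFloor_of_kills continuous_spdOf locusKills_spdOf

/-- **This line's rows imply LINE 31's rows** (order lemma `locRow_of_thickRow`): the thick rows are STRONGER theorems. -/
theorem rowF1bel_of_belT (h : Row_F1belT) : LocRow lambOf := locRow_of_thickRow h
/-- Orders: the calm-thick row gives the calm-dense engine row. -/
theorem rowF1calm_of_calmT (h : Row_F1calmT) : LocRow vortOf := locRow_of_thickRow h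
/-- Orders: the slow-thick row gives the slow-dense row. -/
theorem rowF1slow_of_slowT (h : Row_F1slowT) : Row_F1slow := locRow_of_thickRow h

/-- The generic floor, unfolded at the Lamb defect (reading of `GenericTwistedBalls`). -/
theorem genericTwistedBalls_reading {ν T : ℝ} (hν : 0 < ν) (hT : 0 < T) {u : ℝ → E3 → E3} {p : ℝ → E3 → ℝ}
    (hmax : IsMaximalSmoothSolution ν 0 u p T) (hLH : IsLerayHopfOn T ν 0 (u 0) u)
    (hdec : HasRapidSpatialDecay (u 0)) (hTI : IsTypeIBlowup u T) :
    ∀ δ : ℝ, 0 < δ → ∀ ρ : ℝ, 0 < ρ → ∀ a b η : ℝ, 0 < a → a < b → 0 < η → ∃ ε : ℝ, 0 < ε ∧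
      ∃ᶠ l in 𝓝[>] (0 : ℝ),
        volume (goodTimes lambOf ε δ ρ T ν u ∩ Icc (T - l * b) (T - l * a)) < ENNReal.ofReal (η * l) :=
  (not_thickNear_iff lambOf T ν u).1 (genericTwistedBalls_holds ν T hν hT u p hmax hLH hdec hTI)

/-! ### The splits and the honest residuals -/

/-- **Split**: `Row_F1belT → BelThickSlack → Row_F1`. -/
theorem rowF1_of_belT (hR : Row_F1belT) (hS : BelThickSlack) : ScenarioCensus.Row_F1 := rowF1_of_thickRow hR hS
/-- **Split**: `Row_F1calmT → CalmThickSlack → Row_F1`. -/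
theorem rowF1_of_calmT (hR : Row_F1calmT) (hS : CalmThickSlack) : ScenarioCensus.Row_F1 := rowF1_of_thickRow hR hS
/-- **Split**: `Row_F1slowT → SlowThickSlack → Row_F1`. -/
theorem rowF1_of_slowT (hR : Row_F1slowT) (hS : SlowThickSlack) : ScenarioCensus.Row_F1 := rowF1_of_thickRow hR hS

/-- `Row_F1` gives the Beltrami-thick slack. -/
theorem belThickSlack_of_rowF1 (h : ScenarioCensus.Row_F1) : BelThickSlack := thickSlack_of_rowF1 lambOf h
/-- `Row_F1` gives the calm-thick slack. -/
theorem calmThickSlack_of_rowF1 (h : ScenarioCensus.Row_F1) : CalmThickSlack := thickSlack_of_rowF1 vortOf h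
/-- `Row_F1` gives the slow-thick slack. -/
theorem slowThickSlack_of_rowF1 (h : ScenarioCensus.Row_F1) : SlowThickSlack := thickSlack_of_rowF1 spdOf h

/-- **The three thick residuals are EQUIVALENT to `Row_F1`** (honest label: summit-hard, not claimed). -/
theorem belThickSlack_iff_rowF1 : BelThickSlack ↔ ScenarioCensus.Row_F1 :=
  thickSlack_iff_rowF1 continuous_lambOf thickLocusKills_lambOf
/-- The calm-thick residual is EXACTLY `Row_F1`. -/
theorem calmThickSlack_iff_rowF1 : CalmThickSlack ↔ ScenarioCensus.Row_F1 :=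
  thickSlack_iff_rowF1 continuous_vortOf thickLocusKills_vortOf
/-- The slow-thick residual is EXACTLY `Row_F1`. -/
theorem slowThickSlack_iff_rowF1 : SlowThickSlack ↔ ScenarioCensus.Row_F1 :=
  thickSlack_iff_rowF1 continuous_spdOf thickLocusKills_spdOf

/-- **A thick residual implies LINE 31's dense residual's CONSEQUENCE only through `Row_F1`**; but the thick FLOORS
sharpen LINE 31's floors directly: thick floor ⇒ dense floor. -/
theorem locFloor_of_thickFloor {F : Type*} [NormedAddCommGroup F] {q : Jet → F} (h : ThickFloor q) :
    LocFloor q :=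
  fun ν T hν hT u p hmax hLH hdec hTI hD => h ν T hν hT u p hmax hLH hdec hTI (thickNear_of_denseNear hT hD)

/-- **SUMMARY of the line.** -/
theorem spacetimeLocus_summary :
    Row_F1belT ∧ Row_F1calmT ∧ Row_F1slowT ∧ Row_F1slow ∧
      GenericTwistedBalls ∧ GenericVorticalBalls ∧ GenericFastBalls ∧ RecurrentFastBalls ∧
      (BelThickSlack ↔ ScenarioCensus.Row_F1) ∧ (CalmThickSlack ↔ ScenarioCensus.Row_F1) ∧
      (SlowThickSlack ↔ ScenarioCensus.Row_F1) :=
  ⟨rowF1belT_holds, rowF1calmT_holds, rowF1slowT_holds, rowF1slow_holds, genericTwistedBalls_holds,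
    genericVorticalBalls_holds, genericFastBalls_holds, recurrentFastBalls_holds, belThickSlack_iff_rowF1,
    calmThickSlack_iff_rowF1, slowThickSlack_iff_rowF1⟩

end Summit.NavierStokesRegularity.NavierStokesRegularity.Theorems.ScenarioCensus.SpacetimeLocus

namespace Summit.NavierStokesRegularity.NavierStokesRegularity.Theorems.ScenarioCensus

/-! ## Census KEYS (ns `…Theorems.ScenarioCensus`): the SPACETIME-LOCUS members of row F1 (LINE 32) — TREE-decided F1βT / F1ωT / F1∣u∣T (thick) and F1∣u∣d (dense), floors GTB / GVB / GFB / RFB -/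

/-- **Cell F1βT «BELTRAMI-THICK END»** (row F1 frame VERBATIM + `∃ δ, ρ > 0`, window shape `0 < a < b`, `η > 0`, `∀ ε > 0`, eventually in `l ↓ 0`: the times of `[T−lb, T−la]` at which the `ε`-near-Beltrami points are `δ`-dense in every parabolic ball have measure `≥ ηl` ⇒ smooth extension past `T`): `:= SpacetimeLocus.Row_F1belT`. DECIDED. -/
def Row_F1belT : Prop := SpacetimeLocus.Row_F1belT
/-- F1belT is EXCLUDED (decided in the tree): `SpacetimeLocus.rowF1belT_holds`. -/
theorem row_F1belT_excluded : Row_F1belT := SpacetimeLocus.rowF1belT_holds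

/-- **Cell F1ωT «CALM-THICK END»** (same with `ε`-calm points `(T−t)‖ω‖ < ε`): `:= SpacetimeLocus.Row_F1calmT`. DECIDED. -/
def Row_F1calmT : Prop := SpacetimeLocus.Row_F1calmT
/-- F1calmT is EXCLUDED (decided in the tree): `SpacetimeLocus.rowF1calmT_holds`. -/
theorem row_F1calmT_excluded : Row_F1calmT := SpacetimeLocus.rowF1calmT_holds

/-- **Cell F1∣u∣T «SLOW-THICK END»** (same with `ε`-slow points `√((T−t)/ν)‖u‖ < ε`; kill = analyticity alone): `:= SpacetimeLocus.Row_F1slowT`. DECIDED. -/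
def Row_F1slowT : Prop := SpacetimeLocus.Row_F1slowT
/-- F1slowT is EXCLUDED (decided in the tree): `SpacetimeLocus.rowF1slowT_holds`. -/
theorem row_F1slowT_excluded : Row_F1slowT := SpacetimeLocus.rowF1slowT_holds

/-- **Cell F1∣u∣d «SLOW-DENSE END»** (LINE 31's dense shape for the speed defect): `:= SpacetimeLocus.Row_F1slow`. DECIDED. -/
def Row_F1slow : Prop := SpacetimeLocus.Row_F1slow
/-- F1slow is EXCLUDED (decided in the tree): `SpacetimeLocus.rowF1slow_holds`. -/
theorem row_F1slow_excluded : Row_F1slow := SpacetimeLocus.rowF1slow_holds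

/-- **Floor GTB — SCALE-GENERIC TWISTED BALLS**: `SpacetimeLocus.genericTwistedBalls_holds`. -/
theorem row_F1_genericTwistedBalls : SpacetimeLocus.GenericTwistedBalls := SpacetimeLocus.genericTwistedBalls_holds
/-- **Floor GVB — SCALE-GENERIC VORTICAL BALLS**: `SpacetimeLocus.genericVorticalBalls_holds`. -/
theorem row_F1_genericVorticalBalls : SpacetimeLocus.GenericVorticalBalls := SpacetimeLocus.genericVorticalBalls_holds
/-- **Floor GFB — SCALE-GENERIC FAST BALLS**: `SpacetimeLocus.genericFastBalls_holds`. -/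
theorem row_F1_genericFastBalls : SpacetimeLocus.GenericFastBalls := SpacetimeLocus.genericFastBalls_holds
/-- **Floor RFB — RECURRENT FAST BALLS**: `SpacetimeLocus.recurrentFastBalls_holds`. -/
theorem row_F1_recurrentFastBalls : SpacetimeLocus.RecurrentFastBalls := SpacetimeLocus.recurrentFastBalls_holds
/-- Lattice edge at key level: F1∣u∣T ⇒ F1∣u∣d (`SpacetimeLocus.rowF1slow_of_slowT`). -/
theorem rowF1slow_of_rowF1slowT : Row_F1slowT → Row_F1slow := SpacetimeLocus.rowF1slow_of_slowT

end Summit.NavierStokesRegularity.NavierStokesRegularity.Theorems.ScenarioCensus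

end
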